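import Literature.AlgebraicGeometry.Motives.FiniteQuotient
import Literature.AlgebraicGeometry.Motives.SeparatedQuotient
import HarnessLib

/-!
# The quotient of a TOWER of projective `k`-schemes by a finite group acting compatibly, as a tower

Topic `AlgebraicGeometry/Motives`; namespace `Literature.AlgebraicGeometry.Motives`.  Definitions with bodies and
theorems; no named fact.

Everything level-wise is the tree's `Motives.finiteQuotient` (`Motives/FiniteQuotient.lean`: Mumford, *Abelian
Varieties* §7, Theorem p. 66 and Remark; SGA 1 V §1): for a projective `k`-scheme `Y` the orbits of a finite group of
`k`-automorphisms lie in stable affine opens (`ActionOver.forall_exists_stableAffineOpen_of_isProjectiveOver`), so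
the quotient `Y/Δ` exists as a separated `k`-scheme with an invariant quotient map `π` which is a categorical quotient
for separated test objects (`finiteQuotient.desc` / `mk_desc` / `desc_unique`).  This file supplies:

* §1 `autActionOver ρ` — a homomorphism `ρ : Δ →* Aut Y` into the automorphism group of the `k`-SCHEME `Y`
  (automorphisms in `Over (Spec k)`) as the tree's action datum `ActionOver Y.hom Δ` (forget to `Scheme`; the
  compatibility with `Y → Spec k` is `Over.w`);
* §2 `autQuotient ρ hY : SchemeOver k` (`= finiteQuotient (autActionOver ρ)` for `Y` projective), its quotient map
  `autQuotient.mk`, invariance (`hom_mk`), separatedness (`isSeparated_hom`), the descent `autQuotient.desc` of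
  invariant morphisms to `k`-schemes SEPARATED OVER `k` (the relative hypothesis `IsSeparated W.hom` of
  `Motives.IsSepQuotient`, converted to `W.left.IsSeparated`), cancellation (`hom_ext`), and the packaging
  `autQuotient.isSepQuotient : IsSepQuotient (fun g => ρ g) (autQuotient.mk ρ hY)`;
* §3 FUNCTORIALITY: for a tower `N : J ⥤ SchemeOver k` of projective `k`-schemes with `Δ` acting on every level
  compatibly with the transitions (`(ρ j g) ≫ N.map f = N.map f ≫ (ρ j' g)`), the transition `N.map f ≫ π_{j'}` is
  invariant, hence descends to `N_j/Δ ⟶ N_{j'}/Δ`; `map_id`, `map_comp` and the naturality of `π` follow from the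
  uniqueness of descents — `quotientFunctor N hN ρ hρ : J ⥤ SchemeOver k` and `quotientFunctor.π : N ⟶ quotientFunctor`;
* `exists_quotientFunctor` (any universes) and `exists_finiteQuotient_functor` — the statement of the stub
  `StubQuotientFunctor` of the crux workfile `Cruxes/HypDel/Lines/B1HeckeQuotientDescent.lean` (cell `hodgecm-mathlib`,
  fan B, rung B-I) VERBATIM, so that the stub closes by `exact`.

Use: the finite Hecke-quotient step of Deligne's construction of canonical models ([Deligne1971TravauxShimura]
Prop. 5.11, (5.11.1)): the model of `Sh_K(G)` over the reflex field is the quotient of the model of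
`Sh_{K × L₀}(G × T₀)` by the finite group `Δ = T₀(ℚ)\T₀(𝔸_f)/L₀`, LEVEL BY LEVEL AND COMPATIBLY IN `K` — this file is
the existence of that quotient as a tower.  HC_CM is proved only modulo the 7 printed citations until rung 0 of the
ladder closes; this file is unconditional.

Design: the quotient is CHOSEN (`finiteQuotient`, a gluing), so §2–§3 are `def`s with bodies; the cover hypothesis of
`finiteQuotient.mk` is discharged once (`autActionOver_cover`) from projectivity.  `Δ` finite (`Finite Δ`; the stub's
`Fintype Δ` implies it).  Deliberately NOT here: projectivity of `Y/Δ` (norm of an ample linearised bundle; not needed by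
the line), base change of the quotient (`Motives/FiniteQuotientBaseChange.lean`, seat B-p06), and anything about points.

## References
* [MumfordAV1970] D. Mumford, *Abelian Varieties* (1970), §7 Theorem p. 66 and Remark (categorical quotient).
* [SGA1] A. Grothendieck, M. Raynaud, *SGA 1*, Exp. V §1, Prop. 1.1, Prop. 1.8.
* [Deligne1971TravauxShimura] P. Deligne, *Travaux de Shimura*, Sém. Bourbaki 389 (1971), Prop. 5.11, (5.11.1).
-/

noncomputable section

open CategoryTheory CategoryTheory.Limits AlgebraicGeometry
open Literature.AlgebraicGeometry.RelativeSpec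

namespace Literature.AlgebraicGeometry.Motives

universe u

/-! ### §1 A homomorphism into the automorphisms of a `k`-scheme as an action datum over `Spec k` -/

section AutAction

variable {k : Type u} [Field k] {Y : SchemeOver k} {Δ : Type*} [Group Δ]

/-- **A homomorphism `ρ : Δ →* Aut Y` into the automorphism group of the `k`-scheme `Y` (automorphisms in
`Over (Spec k)`) as the tree's action datum `ActionOver Y.hom Δ`**: forget to automorphisms of the scheme `Y.left`
(`(Over.forget _).mapAut`); they commute with `Y → Spec k` by `Over.w` (Mumford AV §7: «a finite group of
automorphisms of `X`», here of `X/k`). [cite: MumfordAV1970, §7 Thm. p. 66] -/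
def autActionOver (ρ : Δ →* Aut Y) : ActionOver Y.hom Δ where
  aut := ((Over.forget _).mapAut Y).comp ρ
  aut_comp g := Over.w (ρ g).hom

/-- The scheme automorphism underlying `autActionOver ρ g` is `(ρ g).hom.left`. [cite: MumfordAV1970, §7 Thm. p. 66] -/
@[simp]
theorem autActionOver_aut_hom (ρ : Δ →* Aut Y) (g : Δ) : ((autActionOver ρ).aut g).hom = (ρ g).hom.left :=
  rfl

/-- Re-bundled over `Spec k`, the automorphism `autActionOver ρ g` is `ρ g` again:
`((autActionOver ρ).overIso g).hom = (ρ g).hom`. [cite: MumfordAV1970, §7 Thm. p. 66] -/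
@[simp]
theorem autActionOver_overIso_hom (ρ : Δ →* Aut Y) (g : Δ) : ((autActionOver ρ).overIso g).hom = (ρ g).hom :=
  Over.OverMorphism.ext (by rw [ActionOver.overIso_hom_left, autActionOver_aut_hom])

end AutAction

/-! ### §2 One level: the quotient of a projective `k`-scheme by `ρ : Δ →* Aut Y` -/

section Level

variable {k : Type u} [Field k] {Y : SchemeOver k} {Δ : Type*} [Group Δ] [Finite Δ] (ρ : Δ →* Aut Y)

/-- **Mumford's hypothesis for projective `Y`**: every point lies in a `Δ`-stable affine open (the tree's
`ActionOver.forall_exists_stableAffineOpen_of_isProjectiveOver`). [cite: MumfordAV1970, §7 Thm. p. 66]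
[cite: SGA1, Exp. V, Prop. 1.8] -/
theorem autActionOver_cover (hY : IsProjectiveOver Y) :
    ∀ y : Y.left, ∃ O : (autActionOver ρ).StableAffineOpens, y ∈ O.1 :=
  ActionOver.forall_exists_stableAffineOpen_of_isProjectiveOver (autActionOver ρ) hY

variable (hY : IsProjectiveOver Y)

/-- **The quotient `Y/Δ` of a projective `k`-scheme by `ρ : Δ →* Aut Y`**, as a `k`-scheme: the tree's
`Motives.finiteQuotient (autActionOver ρ)` (`Y` is separated over `k` because projective). [cite: MumfordAV1970, §7 Thm. p. 66]
[cite: SGA1, Exp. V, Prop. 1.8] -/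
def autQuotient : SchemeOver k :=
  haveI := hY.isSeparated
  finiteQuotient (autActionOver ρ)

/-- **The quotient map `π : Y ⟶ Y/Δ`** over `k` (the tree's `finiteQuotient.mk`, the cover hypothesis discharged by
projectivity). [cite: MumfordAV1970, §7 Thm. p. 66 (1)] -/
def autQuotient.mk : Y ⟶ autQuotient ρ hY :=
  haveI := hY.isSeparated
  finiteQuotient.mk (autActionOver ρ) (autActionOver_cover ρ hY)

/-- `Y/Δ → Spec k` is separated. [cite: MumfordAV1970, §7 Thm. p. 66; §12] -/
theorem autQuotient.isSeparated_hom : IsSeparated (autQuotient ρ hY).hom :=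
  haveI := hY.isSeparated
  isSeparated_finiteQuotient_hom (autActionOver ρ) (autActionOver_cover ρ hY)

/-- `Y/Δ → Spec k` is proper (`Y` is proper over `k` because projective; SGA 1 V Cor. 1.5).
[cite: SGA1, Exp. V, Cor. 1.5] -/
theorem autQuotient.isProper_hom : IsProper (autQuotient ρ hY).hom :=
  haveI := hY.isProper
  isProper_finiteQuotient_hom (autActionOver ρ) (autActionOver_cover ρ hY)

/-- **`π` is `Δ`-invariant**: `ρ g ≫ π = π`. [cite: MumfordAV1970, §7 Thm. p. 66 (1)] -/
theorem autQuotient.hom_mk (g : Δ) : (ρ g).hom ≫ autQuotient.mk ρ hY = autQuotient.mk ρ hY := by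
  haveI := hY.isSeparated
  have h := finiteQuotient.overIso_hom_mk (autActionOver ρ) (autActionOver_cover ρ hY) g
  rw [autActionOver_overIso_hom] at h
  exact h

/-- A `k`-scheme whose structure morphism is separated is a separated scheme (`Spec k` is separated).
[folklore] -/
private theorem isSeparated_left_of_isSeparated_hom {W : SchemeOver k} (hW : IsSeparated W.hom) :
    W.left.IsSeparated :=
  haveI := hW
  ⟨by rw [← terminal.comp_from W.hom]; infer_instance⟩

/-- **Universal property (existence)**: a `Δ`-invariant `k`-morphism `f : Y ⟶ W` to a `k`-scheme `W` SEPARATED OVER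
`k` factors through `π` (the tree's `finiteQuotient.desc`; Mumford's Remark «`(Y, π)` is a categorical quotient»).
[cite: MumfordAV1970, §7 Thm. p. 66 (Remark)] -/
def autQuotient.desc {W : SchemeOver k} (f : Y ⟶ W) (hW : IsSeparated W.hom) (hf : ∀ g : Δ, (ρ g).hom ≫ f = f) :
    autQuotient ρ hY ⟶ W :=
  haveI := hY.isSeparated
  haveI := isSeparated_left_of_isSeparated_hom hW
  finiteQuotient.desc (autActionOver ρ) (autActionOver_cover ρ hY) f
    (fun g => by rw [autActionOver_overIso_hom]; exact hf g)

/-- `π ≫ desc f = f`. [cite: MumfordAV1970, §7 Thm. p. 66 (Remark)] -/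
theorem autQuotient.mk_desc {W : SchemeOver k} (f : Y ⟶ W) (hW : IsSeparated W.hom)
    (hf : ∀ g : Δ, (ρ g).hom ≫ f = f) : autQuotient.mk ρ hY ≫ autQuotient.desc ρ hY f hW hf = f :=
  haveI := hY.isSeparated
  haveI := isSeparated_left_of_isSeparated_hom hW
  finiteQuotient.mk_desc (autActionOver ρ) (autActionOver_cover ρ hY) f _

/-- **Universal property (uniqueness), as cancellation**: two `k`-morphisms `Y/Δ ⟶ W` to a `k`-scheme separated over
`k` that agree after `π` are equal (the tree's `finiteQuotient.desc_unique`, applied to the invariant morphism `π ≫ b`).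
[cite: MumfordAV1970, §7 Thm. p. 66 (Remark)] -/
theorem autQuotient.hom_ext {W : SchemeOver k} (hW : IsSeparated W.hom) {a b : autQuotient ρ hY ⟶ W}
    (h : autQuotient.mk ρ hY ≫ a = autQuotient.mk ρ hY ≫ b) : a = b := by
  haveI := hY.isSeparated
  haveI := isSeparated_left_of_isSeparated_hom hW
  have hinv : ∀ g : Δ, ((autActionOver ρ).overIso g).hom ≫ autQuotient.mk ρ hY ≫ b = autQuotient.mk ρ hY ≫ b :=
    fun g => by rw [← Category.assoc, autActionOver_overIso_hom, autQuotient.hom_mk]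
  exact (finiteQuotient.desc_unique (autActionOver ρ) (autActionOver_cover ρ hY) _ hinv a h).trans
    (finiteQuotient.desc_unique (autActionOver ρ) (autActionOver_cover ρ hY) _ hinv b rfl).symm

/-- **`π : Y ⟶ Y/Δ` is a quotient of `Y` by the `ρ g` for separated test objects** (`Motives.IsSepQuotient`):
invariance and the unique factorisation of invariant `k`-morphisms to `k`-schemes separated over `k`.
[cite: MumfordAV1970, §7 Thm. p. 66 (Remark)] -/
theorem autQuotient.isSepQuotient : IsSepQuotient (fun g => ρ g) (autQuotient.mk ρ hY) :=
  ⟨fun g => autQuotient.hom_mk ρ hY g, fun _ f hW hf =>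
    ⟨autQuotient.desc ρ hY f hW hf, autQuotient.mk_desc ρ hY f hW hf, fun _ hφ =>
      autQuotient.hom_ext ρ hY hW (by rw [hφ, autQuotient.mk_desc])⟩⟩

end Level

/-! ### §3 The quotient tower -/

section Tower

variable {k : Type u} [Field k] {J : Type*} [Category J] {Δ : Type*} [Group Δ] [Finite Δ]
  (N : J ⥤ SchemeOver k) (hN : ∀ j : J, IsProjectiveOver (N.obj j)) (ρ : ∀ j : J, Δ →* Aut (N.obj j))
  (hρ : ∀ (j j' : J) (f : j ⟶ j') (g : Δ), (ρ j g).hom ≫ N.map f = N.map f ≫ (ρ j' g).hom)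

include hρ in
/-- The transition followed by the quotient map, `N.map f ≫ π_{j'}`, is `Δ`-invariant (compatibility of the action
with the transitions + invariance of `π_{j'}`). [cite: MumfordAV1970, §7 Thm. p. 66 (1)] -/
theorem hom_map_mk (j j' : J) (f : j ⟶ j') (g : Δ) :
    (ρ j g).hom ≫ N.map f ≫ autQuotient.mk (ρ j') (hN j') = N.map f ≫ autQuotient.mk (ρ j') (hN j') := by
  rw [← Category.assoc, hρ, Category.assoc, autQuotient.hom_mk]

/-- **The descended transition `N_j/Δ ⟶ N_{j'}/Δ`** of `N.map f` (descent of the invariant `N.map f ≫ π_{j'}` through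
`π_j`; `N_{j'}/Δ` is separated over `k`). [cite: MumfordAV1970, §7 Thm. p. 66 (Remark)] -/
def quotientFunctorMap {j j' : J} (f : j ⟶ j') : autQuotient (ρ j) (hN j) ⟶ autQuotient (ρ j') (hN j') :=
  autQuotient.desc (ρ j) (hN j) (N.map f ≫ autQuotient.mk (ρ j') (hN j')) (autQuotient.isSeparated_hom _ _)
    (hom_map_mk N hN ρ hρ j j' f)

/-- `π_j ≫ (N.map f)/Δ = N.map f ≫ π_{j'}`. [cite: MumfordAV1970, §7 Thm. p. 66 (Remark)] -/
theorem mk_quotientFunctorMap {j j' : J} (f : j ⟶ j') :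
    autQuotient.mk (ρ j) (hN j) ≫ quotientFunctorMap N hN ρ hρ f = N.map f ≫ autQuotient.mk (ρ j') (hN j') :=
  autQuotient.mk_desc _ _ _ _ _

/-- `(𝟙)/Δ = 𝟙` (uniqueness of descents). [cite: MumfordAV1970, §7 Thm. p. 66 (Remark)] -/
theorem quotientFunctorMap_id (j : J) : quotientFunctorMap N hN ρ hρ (𝟙 j) = 𝟙 _ :=
  autQuotient.hom_ext (ρ j) (hN j) (autQuotient.isSeparated_hom _ _)
    (by rw [mk_quotientFunctorMap, N.map_id, Category.id_comp, Category.comp_id])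

/-- `(f ≫ f')/Δ = f/Δ ≫ f'/Δ` (uniqueness of descents). [cite: MumfordAV1970, §7 Thm. p. 66 (Remark)] -/
theorem quotientFunctorMap_comp {j j' j'' : J} (f : j ⟶ j') (f' : j' ⟶ j'') :
    quotientFunctorMap N hN ρ hρ (f ≫ f') = quotientFunctorMap N hN ρ hρ f ≫ quotientFunctorMap N hN ρ hρ f' :=
  autQuotient.hom_ext (ρ j) (hN j) (autQuotient.isSeparated_hom _ _)
    (by rw [mk_quotientFunctorMap, N.map_comp, Category.assoc, ← Category.assoc (autQuotient.mk (ρ j) (hN j)),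
      mk_quotientFunctorMap, Category.assoc, mk_quotientFunctorMap])

/-- **The quotient tower `N/Δ : J ⥤ SchemeOver k`** of a tower of projective `k`-schemes by a finite group acting
compatibly with the transitions: `(N/Δ)_j = N_j/Δ`, transitions descended. [cite: MumfordAV1970, §7 Thm. p. 66 (Remark)]
[cite: Deligne1971TravauxShimura, Prop. 5.11, (5.11.1)] -/
def quotientFunctor : J ⥤ SchemeOver k where
  obj j := autQuotient (ρ j) (hN j)
  map f := quotientFunctorMap N hN ρ hρ f
  map_id j := quotientFunctorMap_id N hN ρ hρ j
  map_comp f f' := quotientFunctorMap_comp N hN ρ hρ f f'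

/-- **The quotient maps `π_j : N_j ⟶ N_j/Δ` as a morphism of towers `N ⟶ N/Δ`.** [cite: MumfordAV1970, §7 Thm. p. 66 (1)]
[cite: Deligne1971TravauxShimura, (5.11.1)] -/
def quotientFunctor.π : N ⟶ quotientFunctor N hN ρ hρ where
  app j := autQuotient.mk (ρ j) (hN j)
  naturality _ _ f := (mk_quotientFunctorMap N hN ρ hρ f).symm

/-- `(N/Δ)_j = N_j/Δ`. [cite: MumfordAV1970, §7 Thm. p. 66] -/
theorem quotientFunctor_obj (j : J) : (quotientFunctor N hN ρ hρ).obj j = autQuotient (ρ j) (hN j) :=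
  rfl

/-- `π` at level `j` is the quotient map of `N_j`. [cite: MumfordAV1970, §7 Thm. p. 66 (1)] -/
theorem quotientFunctor_π_app (j : J) : (quotientFunctor.π N hN ρ hρ).app j = autQuotient.mk (ρ j) (hN j) :=
  rfl

/-- **Existence of the quotient tower** (any universes): a tower of PROJECTIVE `k`-schemes with a finite group `Δ`
acting on every level by `k`-automorphisms compatibly with the transitions has a quotient tower `q : N ⟶ M` with every
`M_j` separated over `k` and every `q_j` a quotient for separated test objects. [cite: MumfordAV1970, §7 Thm. p. 66]
[cite: SGA1, Exp. V, Prop. 1.8] -/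
theorem exists_quotientFunctor (hN : ∀ j : J, IsProjectiveOver (N.obj j)) (ρ : ∀ j : J, Δ →* Aut (N.obj j))
    (hρ : ∀ (j j' : J) (f : j ⟶ j') (g : Δ), (ρ j g).hom ≫ N.map f = N.map f ≫ (ρ j' g).hom) :
    ∃ (M : J ⥤ SchemeOver k) (q : N ⟶ M),
      (∀ j : J, IsSeparated (M.obj j).hom) ∧
        (∀ j : J, IsProjectiveOver (N.obj j) ∧ IsSepQuotient (fun g => ρ j g) (q.app j)) :=
  ⟨quotientFunctor N hN ρ hρ, quotientFunctor.π N hN ρ hρ, fun j => autQuotient.isSeparated_hom (ρ j) (hN j),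
    fun j => ⟨hN j, autQuotient.isSepQuotient (ρ j) (hN j)⟩⟩

end Tower

/-- **Existence of the quotient tower, in the binders of the stub `StubQuotientFunctor`** of the crux workfile
`Cruxes/HypDel/Lines/B1HeckeQuotientDescent.lean` (cell `hodgecm-mathlib`, fan B, rung B-I; the finite Hecke-quotient
step of [Deligne1971TravauxShimura] (5.11.1) as a tower over the reflex field): the stub closes by `exact` this.
[cite: MumfordAV1970, §7 Thm. p. 66] [cite: Deligne1971TravauxShimura, Prop. 5.11, (5.11.1)] -/
theorem exists_finiteQuotient_functor (L : Type) [Field L] (J : Type) [SmallCategory J] (Δ : Type) [Group Δ]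
    [Fintype Δ] (N : J ⥤ SchemeOver L) (hN : ∀ j : J, IsProjectiveOver (N.obj j))
    (ρ : ∀ j : J, Δ →* Aut (N.obj j))
    (hρ : ∀ (j j' : J) (f : j ⟶ j') (g : Δ), (ρ j g).hom ≫ N.map f = N.map f ≫ (ρ j' g).hom) :
    ∃ (M : J ⥤ SchemeOver L) (q : N ⟶ M),
      (∀ j : J, IsSeparated (M.obj j).hom) ∧
        (∀ j : J, IsProjectiveOver (N.obj j) ∧ IsSepQuotient (fun g => ρ j g) (q.app j)) :=
  exists_quotientFunctor N hN ρ hρ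

end Literature.AlgebraicGeometry.Motives

end
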